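import Literature.NumberTheory.QuadraticFields.IdealClassEpsteinSum
import Literature.NumberTheory.QuadraticFields.FundamentalDiscriminant
import Literature.NumberTheory.LFunctions.DedekindZetaClassSumCont
import HarnessLib

/-!
# The Epstein zeta function of an integral form of fundamental discriminant is twice the
# partial zeta function of an ideal class — on `σ > 1` and for the analytic continuations

Topic `NumberTheory/QuadraticFields`, namespace `Literature.NumberTheory.QuadraticFields.Quadratic`
(continuing `IdealClassEpsteinSum.lean`). Everything here is PROVED (theorems only, no definitions,
no named facts).

Let `K` be an imaginary quadratic field with `d_K < −4` (so `w = 2`), `(1, ω)` an integral basis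
with `ω² = m + tω`, `d_K = t² + 4m`. For ANY integral form `Q = (A, B, C)` with `A > 0` and
`B² − 4AC = d_K` (reduced or not) put `𝔞_Q = (A, ω − (B + t)/2)` (Cox, Thm. 7.7: the ideal
`[a, (−b + √D)/2]`; the same ideal as in `DedekindZetaReducedForms.lean`). Then

* `tsum_ideal_mul_isPrincipal_eq_half_epsteinZeta_of_disc_eq` —
  `Σ_{𝔟 : 𝔞_Q 𝔟 principal} N𝔟^{−s} = ½ Z_Q(s)` for `Re s > 1`
  (`tsum_ideal_mul_isPrincipal_eq_half_twistZeta` with the trivial character, and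
  `Z_{(A,−B,C)} = Z_Q`; the tree's `tsum_ideal_mul_isPrincipal_eq_half_epsteinZeta` of
  `DedekindZetaReducedForms.lean` is the case of a reduced `Q`, with the same proof);
* `classSumCont_eq_half_epsteinZeta` — in terms of the CONTINUED class partial zeta functions
  `ζ(𝔎, s) = Literature.NumberTheory.LFunctions.NumberField.classSumCont` of
  `LFunctions/DedekindZetaClassSumCont.lean` (Neukirch VII (5.9)–(5.11)): for the class
  `𝔎 = [𝔞_Q]⁻¹` and `Re s > 1`, `ζ(𝔎, s) = ½ Z_Q(s)` (the ideals `𝔟 ≠ 0` with `𝔞_Q 𝔟` principal are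
  exactly the integral ideals of `[𝔞_Q]⁻¹`, Mathlib `ClassGroup.mk0_eq_mk0_inv_iff`; `𝔟 = 0`
  contributes `N0^{−s} = 0`);
* `IsEpsteinContinuation.eq_two_mul_classSumCont` — **uniqueness of continuation**: every `Z`
  holomorphic on `ℂ ∖ {1}` agreeing with `Z_Q` on `σ > 1`
  (`Literature.Barriers.RiemannHypothesis.IsEpsteinContinuation`) satisfies `Z(s) = 2 ζ(𝔎, s)` for
  all `s ≠ 1` (identity theorem on the connected open set `ℂ ∖ {1}`);
* `exists_classSumCont_eq_of_isFundamentalDiscriminant` — the same packaged from the hypotheses of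
  the barrier facts `Literature.Barriers.RiemannHypothesis.DavenportHeilbronn1936b_epstein` and
  `Literature.Barriers.RiemannHypothesis.Voronin1976_epsteinStrip` (`a, b, c ∈ ℤ`, `a > 0`,
  `d = b² − 4ac` a fundamental discriminant, `d < −4`): there is a quadratic field `K` with
  `d_K = d` (`exists_numberField_discr_eq`) and a class `𝔎 ∈ Cl(K)` with `ζ(𝔎, s) = ½ ζ_Q(s)`
  (`σ > 1`) and `Z = 2 ζ(𝔎, ·)` off `s = 1` for every continuation `Z` of `ζ_Q`.

This is the first step "`ζ_Q(s) = w ζ(s, A)`" (Zagier, *Zetafunktionen und quadratische Körper*,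
§8 Satz 3) of the Davenport–Heilbronn / Voronin / Bauer treatment of the zeros of Epstein zeta
functions of class number `> 1` through the partial zeta functions `ζ(s, A) = h⁻¹ Σ_χ χ̄(A) L(s, χ)`
(Steuding, *Value-Distribution of L-Functions*, p. 235: "the zeta-function of an ideal class of an
imaginary quadratic field"), here made available for the continued functions. Not here: class
group characters and the `L(s, χ)`.

## References

* [Cox2013] D. A. Cox, *Primes of the form x² + ny²*, 2nd ed. (2013), §7.B Thm. 7.7.
* [NeukirchANT1999] J. Neukirch, *Algebraic Number Theory* (1999), Ch. VII (5.9)–(5.11).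
* D. B. Zagier, *Zetafunktionen und quadratische Körper*, Springer 1981, §8 Satz 3.
* [Steuding2007] J. Steuding, *Value-Distribution of L-Functions*, LNM 1877, p. 235.
-/

noncomputable section

open Module NumberField Ideal Complex Filter Set
open Literature.Barriers.RiemannHypothesis Literature.NumberTheory.QuadraticFields.BakerLimitFormula
open Literature.NumberTheory.LFunctions.NumberField (classSumCont classSumCont_eq_tsum
  differentiableOn_classSumCont thetaIdeal_inv_holds)
open scoped nonZeroDivisors

namespace Literature.NumberTheory.QuadraticFields.Quadratic

/-! ### Arithmetic of a form of discriminant `t² + 4m`, and two small identities -/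

/-- If `B² − 4AC = t² + 4m` then `B ≡ t (mod 2)`: `2 · ((B + t)/2) = B + t`. [folklore] -/
private theorem two_mul_half_add (A B C t m : ℤ) (h : B ^ 2 - 4 * A * C = t ^ 2 + 4 * m) :
    2 * ((B + t) / 2) = B + t := by
  have h2 : (2 : ℤ) ∣ B + t := by
    have hprod : (2 : ℤ) ∣ (B - t) * (B + t) := ⟨2 * (A * C + m), by linear_combination h⟩
    rcases Int.prime_two.dvd_or_dvd hprod with h1 | h1
    · have : B + t = (B - t) + 2 * t := by ring
      rw [this]
      exact dvd_add h1 (dvd_mul_right 2 t)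
    · exact h1
  obtain ⟨c, hc⟩ := h2
  omega

/-- If `B² − 4AC = t² + 4m` and `2k = B + t` then `AC = k² − tk − m` (the norm condition making
`(A, ω − k)` a lattice ideal, `FormIdeals.lean`). [folklore] -/
private theorem norm_cond_of_disc (A B C t m k : ℤ) (h : B ^ 2 - 4 * A * C = t ^ 2 + 4 * m)
    (hk : 2 * k = B + t) : A * C = k ^ 2 - t * k - m := by
  have hB : B = 2 * k - t := by linarith
  subst hB
  nlinarith [h]

/-- The Epstein zeta function is unchanged by `b ↦ −b` (substitute `y ↦ −y`). [folklore] -/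
private theorem epsteinZeta_neg_middle (a b c : ℝ) (s : ℂ) :
    epsteinZeta a (-b) c s = epsteinZeta a b c s := by
  unfold epsteinZeta
  rw [← (Equiv.prodCongr (Equiv.refl ℤ) (Equiv.neg ℤ)).tsum_eq (epsteinTerm a (-b) c s)]
  refine tsum_congr fun p => ?_
  obtain ⟨x, y⟩ := p
  simp only [Equiv.prodCongr_apply, Equiv.coe_refl, Prod.map_apply, id_eq, Equiv.neg_apply,
    epsteinTerm]
  have h0 : ((x, -y) : ℤ × ℤ) = 0 ↔ ((x, y) : ℤ × ℤ) = 0 := by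
    simp [Prod.ext_iff]
  by_cases hp : ((x, y) : ℤ × ℤ) = 0
  · rw [if_pos (h0.2 hp), if_pos hp]
  · rw [if_neg (fun h => hp (h0.1 h)), if_neg hp]
    congr 2
    unfold bqfEval
    push_cast
    ring

/-- `ℂ ∖ {1}` is preconnected (complement of a countable set in a real vector space of rank `> 1`):
the tree's `Literature.Barriers.RiemannHypothesis.isPreconnected_compl_one`
(`EpsteinZetaCentralValue.lean`). [folklore] -/
private theorem isPreconnected_ne_one : IsPreconnected {s : ℂ | s ≠ 1} :=
  Literature.Barriers.RiemannHypothesis.isPreconnected_compl_one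

section Basis

variable {K : Type*} [Field K] [NumberField K]

omit [NumberField K] in
/-- The ideal `(A, ω − k)` is non-zero for `A ≠ 0` (its element `A` is a non-zero integer,
`intCast_eq_zero_of_basis`). [folklore] -/
theorem span_pair_intCast_mem_nonZeroDivisors (b : Basis (Fin 2) ℤ (𝓞 K)) (hb : b 0 = 1)
    {A : ℤ} (hA : A ≠ 0) (x : 𝓞 K) : Ideal.span {(A : 𝓞 K), x} ∈ (Ideal (𝓞 K))⁰ := by
  rw [mem_nonZeroDivisors_iff_ne_zero, ne_eq, Submodule.zero_eq_bot, Ideal.span_eq_bot]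
  push Not
  exact ⟨(A : 𝓞 K), by simp, fun h ↦ hA (intCast_eq_zero_of_basis b hb h)⟩

/-- **The class sum of an arbitrary form of discriminant `d_K`, untwisted**: for `Q = (A, B, C)`
integral with `A > 0`, `B² − 4AC = t² + 4m = d_K < −4` and `Re s > 1`,
`Σ_{𝔟 : 𝔞_Q 𝔟 principal} N𝔟^{−s} = ½ Z_Q(s)`, `𝔞_Q = (A, ω − (B + t)/2)`
(`tsum_ideal_mul_isPrincipal_eq_half_twistZeta` with the trivial character; `Z_{(A,−B,C)} = Z_Q`).
[cite: Cox2013, §7.B Thm. 7.7] -/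
theorem tsum_ideal_mul_isPrincipal_eq_half_epsteinZeta_of_disc_eq (b : Basis (Fin 2) ℤ (𝓞 K))
    (hb : b 0 = 1) {t m : ℤ} (hω : b 1 * b 1 = (m : 𝓞 K) + (t : 𝓞 K) * b 1)
    (hD : t ^ 2 + 4 * m < -4) {A B C : ℤ} (hA : 0 < A)
    (hdisc : B ^ 2 - 4 * A * C = t ^ 2 + 4 * m) {s : ℂ} (hs : 1 < s.re) :
    ∑' J : {J : Ideal (𝓞 K) //
        (span {(A : 𝓞 K), b 1 - (((B + t) / 2 : ℤ) : 𝓞 K)} * J).IsPrincipal},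
        ((absNorm J.1 : ℕ) : ℂ) ^ (-s) =
      1 / 2 * epsteinZeta (A : ℝ) (B : ℝ) (C : ℝ) s := by
  set k : ℤ := (B + t) / 2 with hk
  have h2k : 2 * k = B + t := two_mul_half_add A B C t m hdisc
  have hn : A * C = k ^ 2 - t * k - m := norm_cond_of_disc A B C t m k hdisc h2k
  have h := tsum_ideal_mul_isPrincipal_eq_half_twistZeta b hb hω hD hA hn
    (1 : DirichletCharacter ℂ 1) hs
  have hψ : ∀ x : ZMod 1, (1 : DirichletCharacter ℂ 1) x = 1 := fun x => by
    rw [Subsingleton.elim x 1, map_one]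
  simp only [hψ, one_mul] at h
  have h1 : twistZeta (fun _ : ℤ × ℤ => (1 : ℂ)) (A : ℝ) ((t - 2 * k : ℤ) : ℝ) (C : ℝ) s =
      epsteinZeta (A : ℝ) ((t - 2 * k : ℤ) : ℝ) (C : ℝ) s := by
    unfold twistZeta epsteinZeta
    exact tsum_congr fun p => by simp [twistTerm]
  rw [h, h1, show ((t - 2 * k : ℤ) : ℝ) = -(B : ℝ) by
    have : t - 2 * k = -B := by linarith
    rw [this]; push_cast; ring, epsteinZeta_neg_middle]

/-- **`ζ([𝔞_Q]⁻¹, s) = ½ Z_Q(s)` for `Re s > 1`**, with `ζ(𝔎, s)` the continued partial zeta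
function `classSumCont` of the class `𝔎` (which equals `Σ_{𝔟 ∈ 𝔎} N𝔟^{−s}` for `Re s > 1`,
Neukirch VII (5.9)): the non-zero `𝔟` with `𝔞_Q 𝔟` principal are the integral ideals of the class
`[𝔞_Q]⁻¹` (Mathlib `ClassGroup.mk0_eq_mk0_inv_iff`), and `𝔟 = 0` contributes `N0^{−s} = 0`. The
membership `h𝔞 : 𝔞_Q ∈ (Ideal 𝓞_K)⁰` (e.g. `span_pair_intCast_mem_nonZeroDivisors`) only names the
class. [cite: Cox2013, §7.B Thm. 7.7] [cite: NeukirchANT1999, Ch. VII (5.9), (5.10)] -/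
theorem classSumCont_eq_half_epsteinZeta (b : Basis (Fin 2) ℤ (𝓞 K)) (hb : b 0 = 1)
    {t m : ℤ} (hω : b 1 * b 1 = (m : 𝓞 K) + (t : 𝓞 K) * b 1) (hD : t ^ 2 + 4 * m < -4)
    {A B C : ℤ} (hA : 0 < A) (hdisc : B ^ 2 - 4 * A * C = t ^ 2 + 4 * m)
    (h𝔞 : span {(A : 𝓞 K), b 1 - (((B + t) / 2 : ℤ) : 𝓞 K)} ∈ (Ideal (𝓞 K))⁰)
    {s : ℂ} (hs : 1 < s.re) :
    classSumCont (thetaIdeal_inv_holds K) (ClassGroup.mk0 ⟨_, h𝔞⟩)⁻¹ s =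
      1 / 2 * epsteinZeta (A : ℝ) (B : ℝ) (C : ℝ) s := by
  classical
  have hs0 : -s ≠ 0 := neg_ne_zero.mpr fun h => by rw [h, Complex.zero_re] at hs; linarith
  set 𝔞 : Ideal (𝓞 K) := span {(A : 𝓞 K), b 1 - (((B + t) / 2 : ℤ) : 𝓞 K)} with h𝔞def
  set cl : ClassGroup (𝓞 K) := (ClassGroup.mk0 ⟨𝔞, h𝔞⟩)⁻¹ with hcl
  rw [classSumCont_eq_tsum _ cl hs,
    ← tsum_ideal_mul_isPrincipal_eq_half_epsteinZeta_of_disc_eq b hb hω hD hA hdisc hs]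
  set f : Ideal (𝓞 K) → ℂ := fun J => ((absNorm J : ℕ) : ℂ) ^ (-s) with hf
  have hf0 : f ⊥ = 0 := by
    simp only [hf, Ideal.absNorm_bot, Nat.cast_zero, Complex.zero_cpow hs0]
  -- the class condition is the principality condition
  have hiff : ∀ I : (Ideal (𝓞 K))⁰,
      ClassGroup.mk0 I = cl ↔ (𝔞 * (I : Ideal (𝓞 K))).IsPrincipal := by
    intro I
    rw [hcl, ClassGroup.mk0_eq_mk0_inv_iff]
    constructor
    · rintro ⟨x, -, hx⟩
      exact ⟨⟨x, by rw [mul_comm]; exact hx⟩⟩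
    · rintro ⟨⟨x, hx⟩⟩
      refine ⟨x, ?_, by rw [mul_comm]; exact hx⟩
      rintro rfl
      have h0 : 𝔞 * (I : Ideal (𝓞 K)) = ⊥ := by rw [hx]; simp
      exact (mul_ne_zero (nonZeroDivisors.ne_zero h𝔞) (nonZeroDivisors.ne_zero I.2)) h0
  -- both sums are `Σ_J [J ≠ 0, 𝔞 J principal] f J`
  set ι : {I : (Ideal (𝓞 K))⁰ // ClassGroup.mk0 I = cl} → Ideal (𝓞 K) := fun I => I.1.1 with hι
  have hinj : Function.Injective ι := fun I J h => Subtype.ext (Subtype.ext h)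
  have hrange : Set.range ι = {J : Ideal (𝓞 K) | J ≠ ⊥ ∧ (𝔞 * J).IsPrincipal} := by
    ext J
    constructor
    · rintro ⟨I, rfl⟩
      exact ⟨nonZeroDivisors.ne_zero I.1.2, (hiff I.1).1 I.2⟩
    · rintro ⟨hJ0, hJ⟩
      exact ⟨⟨⟨J, mem_nonZeroDivisors_of_ne_zero hJ0⟩, (hiff _).2 hJ⟩, rfl⟩
  have hind : {J : Ideal (𝓞 K) | J ≠ ⊥ ∧ (𝔞 * J).IsPrincipal}.indicator f =
      {J : Ideal (𝓞 K) | (𝔞 * J).IsPrincipal}.indicator f := by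
    funext J
    by_cases hJ : J = ⊥
    · subst hJ
      rw [Set.indicator_apply, Set.indicator_apply]
      split_ifs <;> first | rfl | exact hf0 | exact hf0.symm
    · by_cases hp : (𝔞 * J).IsPrincipal
      · rw [Set.indicator_of_mem (show J ∈ {J : Ideal (𝓞 K) | J ≠ ⊥ ∧ (𝔞 * J).IsPrincipal}
          from ⟨hJ, hp⟩), Set.indicator_of_mem (show J ∈ {J : Ideal (𝓞 K) | (𝔞 * J).IsPrincipal}
          from hp)]
      · rw [Set.indicator_of_notMem (fun h : J ∈ {J : Ideal (𝓞 K) | J ≠ ⊥ ∧ (𝔞 * J).IsPrincipal}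
          => hp h.2), Set.indicator_of_notMem (fun h : J ∈ {J : Ideal (𝓞 K) | (𝔞 * J).IsPrincipal}
          => hp h)]
  calc ∑' I : {I : (Ideal (𝓞 K))⁰ // ClassGroup.mk0 I = cl}, ((absNorm I.1.1 : ℕ) : ℂ) ^ (-s)
      = ∑' I : {I : (Ideal (𝓞 K))⁰ // ClassGroup.mk0 I = cl}, f (ι I) := rfl
    _ = ∑' J : Set.range ι, f J := (tsum_range f hinj).symm
    _ = ∑' J : {J : Ideal (𝓞 K) | J ≠ ⊥ ∧ (𝔞 * J).IsPrincipal}, f J :=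
        tsum_congr_set_coe f hrange
    _ = ∑' J, {J : Ideal (𝓞 K) | J ≠ ⊥ ∧ (𝔞 * J).IsPrincipal}.indicator f J := tsum_subtype _ f
    _ = ∑' J, {J : Ideal (𝓞 K) | (𝔞 * J).IsPrincipal}.indicator f J := by rw [hind]
    _ = ∑' J : {J : Ideal (𝓞 K) | (𝔞 * J).IsPrincipal}, f J := (tsum_subtype _ f).symm
    _ = ∑' J : {J : Ideal (𝓞 K) // (𝔞 * J).IsPrincipal}, ((absNorm J.1 : ℕ) : ℂ) ^ (-s) := rfl

/-- **Every analytic continuation of `ζ_Q` is twice the continued partial zeta function of the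
class `[𝔞_Q]⁻¹`**: if `Z` is holomorphic on `ℂ ∖ {1}` and equals `Z_Q = ζ_Q` on `σ > 1`
(`IsEpsteinContinuation`), then `Z(s) = 2 ζ([𝔞_Q]⁻¹, s)` for every `s ≠ 1` — both sides are
holomorphic on the connected open set `ℂ ∖ {1}` and agree on `σ > 1`
(`classSumCont_eq_half_epsteinZeta`), so the identity theorem applies (Zagier §8 Satz 3,
"`ζ(s, A) = (1/w) Σ' Q(x,y)^{−s}`", `w = 2`, for the continued functions).
[cite: Cox2013, §7.B Thm. 7.7] [cite: NeukirchANT1999, Ch. VII (5.10), (5.11)] -/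
theorem _root_.Literature.Barriers.RiemannHypothesis.IsEpsteinContinuation.eq_two_mul_classSumCont
    (b : Basis (Fin 2) ℤ (𝓞 K)) (hb : b 0 = 1)
    {t m : ℤ} (hω : b 1 * b 1 = (m : 𝓞 K) + (t : 𝓞 K) * b 1) (hD : t ^ 2 + 4 * m < -4)
    {A B C : ℤ} (hA : 0 < A) (hdisc : B ^ 2 - 4 * A * C = t ^ 2 + 4 * m)
    (h𝔞 : span {(A : 𝓞 K), b 1 - (((B + t) / 2 : ℤ) : 𝓞 K)} ∈ (Ideal (𝓞 K))⁰)
    {Z : ℂ → ℂ} (hZ : IsEpsteinContinuation (A : ℝ) (B : ℝ) (C : ℝ) Z) {s : ℂ} (hs : s ≠ 1) :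
    Z s = 2 * classSumCont (thetaIdeal_inv_holds K) (ClassGroup.mk0 ⟨_, h𝔞⟩)⁻¹ s := by
  set cl : ClassGroup (𝓞 K) := (ClassGroup.mk0 ⟨_, h𝔞⟩)⁻¹ with hcl
  set W : ℂ → ℂ := fun z => 2 * classSumCont (thetaIdeal_inv_holds K) cl z with hW
  have hopen : IsOpen {s : ℂ | s ≠ 1} := isOpen_ne
  have hWd : DifferentiableOn ℂ W {s : ℂ | s ≠ 1} := by
    have h := differentiableOn_classSumCont (thetaIdeal_inv_holds K) cl
    have e : ({1}ᶜ : Set ℂ) = {s : ℂ | s ≠ 1} := by ext s; simp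
    rw [e] at h
    exact (differentiableOn_const (2 : ℂ)).mul h
  have hZa := hZ.1.analyticOnNhd hopen
  have hWa := hWd.analyticOnNhd hopen
  have h2 : (2 : ℂ) ∈ {s : ℂ | s ≠ 1} := by norm_num
  refine hZa.eqOn_of_preconnected_of_eventuallyEq hWa isPreconnected_ne_one h2 ?_ hs
  have hnhds : {s : ℂ | 1 < s.re} ∈ nhds (2 : ℂ) :=
    (isOpen_lt continuous_const Complex.continuous_re).mem_nhds (by norm_num)
  filter_upwards [hnhds] with z hz
  rw [hZ.2 z hz, hW]
  simp only
  rw [classSumCont_eq_half_epsteinZeta b hb hω hD hA hdisc h𝔞 hz]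
  ring

end Basis

/-- **From the hypotheses of the Epstein barrier facts.** Let `a, b, c ∈ ℤ` with `a > 0` and
`d = b² − 4ac` a fundamental discriminant with `d < −4` (as in
`Literature.Barriers.RiemannHypothesis.DavenportHeilbronn1936b_epstein` and
`Literature.Barriers.RiemannHypothesis.Voronin1976_epsteinStrip`, where `h(d) > 1` forces
`d ∉ {−3, −4}`). Then there are a quadratic field `K` with `d_K = d`
(`exists_numberField_discr_eq`) and an ideal class `𝔎` of `K` such that
`ζ(𝔎, s) = ½ ζ_Q(s)` for `σ > 1` and `Z(s) = 2 ζ(𝔎, s)` (`s ≠ 1`) for every analytic continuation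
`Z` of `ζ_Q`: the "zeta-function of an ideal class of an imaginary quadratic field" of
Davenport–Heilbronn and Voronin (Steuding, p. 235) is `½ ζ_Q`.
[cite: Cox2013, §7.B Thm. 7.7] [cite: NeukirchANT1999, Ch. VII (5.10), (5.11)] -/
theorem exists_classSumCont_eq_of_isFundamentalDiscriminant {a b c : ℤ} (ha : 0 < a)
    (hd : IsFundamentalDiscriminant (b ^ 2 - 4 * a * c)) (h4 : b ^ 2 - 4 * a * c < -4) :
    ∃ (K : Type) (_ : Field K) (_ : NumberField K) (𝔎 : ClassGroup (𝓞 K)),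
      Module.finrank ℚ K = 2 ∧ NumberField.discr K = b ^ 2 - 4 * a * c ∧
      (∀ s : ℂ, 1 < s.re →
        classSumCont (thetaIdeal_inv_holds K) 𝔎 s =
          1 / 2 * epsteinZeta (a : ℝ) (b : ℝ) (c : ℝ) s) ∧
      ∀ Z : ℂ → ℂ, IsEpsteinContinuation (a : ℝ) (b : ℝ) (c : ℝ) Z → ∀ s : ℂ, s ≠ 1 →
        Z s = 2 * classSumCont (thetaIdeal_inv_holds K) 𝔎 s := by
  obtain ⟨K, _, _, h2, hdK⟩ := exists_numberField_discr_eq hd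
  obtain ⟨bK, hbK⟩ := exists_basis_zero_eq_one (K := K) h2
  have hω := basis_one_mul_self_eq bK hbK
  have hdisc' := discr_eq_sq_add_four_mul bK hbK
  set m : ℤ := bK.repr (bK 1 * bK 1) 0 with hm
  set t : ℤ := bK.repr (bK 1 * bK 1) 1 with ht
  have hdisc : b ^ 2 - 4 * a * c = t ^ 2 + 4 * m := by rw [← hdK, hdisc']
  have hD : t ^ 2 + 4 * m < -4 := by rw [← hdisc]; exact h4
  have h𝔞 := span_pair_intCast_mem_nonZeroDivisors bK hbK ha.ne'
    (bK 1 - (((b + t) / 2 : ℤ) : 𝓞 K))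
  exact ⟨K, inferInstance, inferInstance, (ClassGroup.mk0 ⟨_, h𝔞⟩)⁻¹, h2, hdK,
    fun s hs => classSumCont_eq_half_epsteinZeta bK hbK hω hD ha hdisc h𝔞 hs,
    fun Z hZ s hs => hZ.eq_two_mul_classSumCont bK hbK hω hD ha hdisc h𝔞 hs⟩

end Literature.NumberTheory.QuadraticFields.Quadratic
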